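/-
Copyright (c) 2026 the pub-hodgecm-mathlib formalisation cell (harness21).  Prover seat hodgecm-mathlib-K2E2-p12 (g6): Track B «K2-LIT», ENGINE E1,
h413 = stmt-HodgeConjecture-24833; R8₂-sph ROAD T′, road (A) GELFAND, deal (144)(ii-b) of K2E1-plan (g7), print: GELFAND'S TRICK AT `U(1,1)` — the orbital operators and the Hecke
sandwiches of every unitary representation of `U(1,1)` commute ((LOC) of ★ `K2E1HeckeCommuteGluingU` at the real places of `U(Φ₂)`, `N = 2`).
-/
import Summits.HodgeConjecture.HodgeConjecture.Theorems.K2E1U11TransposeConjugate      -- ★ (this seat, p859876): `exists_transposeMap_one_one`, `exists_KV_invAut_of_subsingleton`, `coe_kV_transpose_of_subsingleton`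
import Summits.HodgeConjecture.HodgeConjecture.Theorems.K2E1HeckeCommuteOfOrbitalU      -- ★ (this seat, p859855): `commute_sandwich_of_commute_orbitalOp` (+ ★ `ClosedCompactDecomposition`)
import HarnessLib

/-!
# K2·E1 — `K2E1HeckeCommuteOfOrbitalU11` (deal (144)(ii-b), print): AT `U(1,1)` THE ORBITAL OPERATORS OF EVERY UNITARY REPRESENTATION COMMUTE (Gelfand's trick for the transpose), HENCE
# SO DO THE HECKE SANDWICHES `P_K σ(x) P_K` — the per-place letter (LOC) of ★ `K2E1HeckeCommuteGluingU` at the archimedean places for `N = 2` [Helgason Ch. IV §3 Thm. 3.1; Lang SL₂(ℝ) IV §1]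

Track B ∕ K2-LIT, crux h413 = `stmt-HodgeConjecture-24833`, route of record `HCCMUnconditional`; cell `hodgecm-mathlib`, squad K2, ENGINE E1 (R8₂-sph ROAD T′, road (A) GELFAND:
(A3) ★ p859707 ← GLUING ★ p859808 ← (LOC)_∞ via ★ p859855 `commute_sandwich_of_commute_orbitalOp` ← ORBITAL commutativity ★ `commute_orbitalOp_of_antiHom` ← «`gᵀ ∈ Ad(K) g`» ★ p859876).
THEOREMS ONLY (no `def`, no `instance`, no notation, no `sorry`; default heartbeats); lane `--supports stmt-HodgeConjecture-24833 --as helper` (count-neutral).  The `U(2,1)` twins are ★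
`commute_orbitalOp_uFormGroup_two_one` ∕ ★ `commute_sandwich_uFormGroup_two_one`.

* §1 `measurePreserving_continuousMulEquiv` — a continuous automorphism of a compact group preserves a Haar probability measure (Mathlib `MonoidHom.measurePreserving`; ★'s copy is private).
* §2 **`commute_orbitalOp_uFormGroup_one_one`**: for every unitary strongly continuous representation `σ` of (the carrier of) `U(1,1) = uFormGroup α β` (`|α| = |β| = 1`) and every two-sided,
  inversion invariant Haar probability measure `μ` on `K = U(α) × U(β)`, the orbital operators `O_x = ∫_K σ(ιk·x·ιk⁻¹) dμ` pairwise commute — ★ Gelfand's trick with `σ = transpose` (anti-homomorphism,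
  ★ `exists_transposeMap_one_one`), `θ = inversion` of the abelian `K` (★ `exists_KV_invAut_of_subsingleton`; `(kV k)ᵀ = kV k` ★ gives the compatibility `(ιK k)ᵀ = ιK k = (ιK k⁻¹)⁻¹`).
* §3 **`commute_sandwich_uFormGroup_one_one`**: hence, with `P` the orthogonal projection onto the `K`-fixed vectors, **`∀ x y, Commute (P * σ x * P) (P * σ y * P)`** — measure-free statement
  (★ bridge `commute_sandwich_of_commute_orbitalOp`; Haar probability measure built inside) = (LOC) at a real place of signature `(1,1)`.
HONEST LABEL: HC_CM is proved only modulo the 7 printed citations (2 remaining named inputs: hLiu418 = `stmt-HodgeConjecture-24832`, h413 = `stmt-HodgeConjecture-24833`) until rung 0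
closes; this file asserts no named fact and closes no socket; count-neutral; unconditional.

## References
* [Helgason2000] S. Helgason, *Groups and Geometric Analysis*, AMS (2000): Ch. IV §3, Thm. 3.1 (Gelfand's lemma).
* [DeitmarEchterhoff2014] A. Deitmar, S. Echterhoff, *Principles of Harmonic Analysis*, 2nd ed. (2014): Lemma 6.1.7, Lemma 7.3.1.
* [Knapp2002] A. W. Knapp, *Lie Groups Beyond an Introduction*, 2nd ed. (2002): Thm. 7.39.
* [Bump1997] D. Bump, *Automorphic Forms and Representations* (1997): Thm. 2.4.2 (uniqueness of the `K`-fixed vector for `GL(2, ℝ)`).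
-/

set_option autoImplicit false
set_option linter.dupNamespace false -- the mandated namespace repeats `HodgeConjecture.HodgeConjecture`

noncomputable section

open MeasureTheory Measure Matrix ContRepresentation
open Literature.NumberTheory.Automorphic Literature.RepresentationTheory.BorelWallach2000 Literature.RepresentationTheory.CompactGroups
open Literature.RepresentationTheory.KonnoKonno2007 Literature.RepresentationTheory.KonnoKonno2007.RealDualPair
open Summit.HodgeConjecture.HodgeConjecture.Cruxes.H413.K2E1U11TransposeConjugate
open Summit.HodgeConjecture.HodgeConjecture.Cruxes.H413.K2E1HeckeCommuteOfOrbitalU (commute_sandwich_of_commute_orbitalOp)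

namespace Summit.HodgeConjecture.HodgeConjecture.Cruxes.H413.K2E1HeckeCommuteOfOrbitalU11

/-! ## §1 Continuous automorphisms of a compact group preserve a Haar probability measure -/

/-- A continuous automorphism `θ` of a compact group preserves every Haar probability measure (Mathlib `MonoidHom.measurePreserving`: `θ_* μ` is a Haar probability measure, hence `= μ`).
[cite: DeitmarEchterhoff2014, Lemma 7.3.1] -/
theorem measurePreserving_continuousMulEquiv {K : Type*} [Group K] [TopologicalSpace K] [IsTopologicalGroup K] [CompactSpace K] [MeasurableSpace K] [BorelSpace K]
    (μ : Measure K) [μ.IsHaarMeasure] (θ : K ≃ₜ* K) : MeasurePreserving θ μ μ :=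
  θ.toMulEquiv.toMonoidHom.measurePreserving θ.continuous θ.surjective rfl

/-! ## §2 The orbital operators of a unitary representation of `U(1,1)` commute -/

variable {α β : Type*} [Fintype α] [DecidableEq α] [Fintype β] [DecidableEq β]

/-- **Gelfand's trick at `U(1,1)`.**  For every unitary strongly continuous representation `σ` of the carrier of `U(1,1) = uFormGroup α β` (`|α| = |β| = 1`) and every two-sided and inversion
invariant Haar probability measure `μ` on `K = U(α) × U(β)` (embedded by `ιK = incl ∘ upqMaximalCompactEquiv⁻¹`), the orbital operators `O_x = ∫_K σ(ιk · x · ιk⁻¹) dμ(k)` pairwise commute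
(★ `commute_orbitalOp_of_antiHom` for the transpose ★ `exists_transposeMap_one_one`, `θ = inversion` ★ `exists_KV_invAut_of_subsingleton`). [cite: Helgason2000, Ch. IV §3 Thm. 3.1] [cite: Knapp2002, Thm. 7.39] -/
theorem commute_orbitalOp_uFormGroup_one_one [Unique α] [Unique β] [MeasurableSpace (KV α β)] [BorelSpace (KV α β)]
    [CompactSpace (KV α β)] [SecondCountableTopology (KV α β)]
    (μ : Measure (KV α β)) [μ.IsHaarMeasure] [IsProbabilityMeasure μ] [μ.IsMulRightInvariant] [μ.IsInvInvariant]
    {E : Type*} [NormedAddCommGroup E] [InnerProductSpace ℂ E] [CompleteSpace E]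
    (π : ContRepresentation ℂ ↥(uFormGroup α β).carrier E) (hπ : π.IsStronglyContinuous) (hU : π.IsUnitary)
    (hι : Continuous ((Subgroup.inclusion (uFormGroup α β).maximalCompact_le_carrier).comp
      (upqMaximalCompactEquiv (α := α) (β := β)).symm.toMulEquiv.toMonoidHom))
    (x y : ↥(uFormGroup α β).carrier) :
    Commute
      (orbitalOp μ ((Subgroup.inclusion (uFormGroup α β).maximalCompact_le_carrier).comp
        (upqMaximalCompactEquiv (α := α) (β := β)).symm.toMulEquiv.toMonoidHom) π hι hπ hU x)
      (orbitalOp μ ((Subgroup.inclusion (uFormGroup α β).maximalCompact_le_carrier).comp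
        (upqMaximalCompactEquiv (α := α) (β := β)).symm.toMulEquiv.toMonoidHom) π hι hπ hU y) := by
  obtain ⟨θ, hθ⟩ := exists_KV_invAut_of_subsingleton (α := α) (β := β)
  obtain ⟨σ, hσmat, hσmul, hσconj⟩ := exists_transposeMap_one_one (α := α) (β := β)
  set ιK : KV α β →* ↥(uFormGroup α β).carrier :=
    (Subgroup.inclusion (uFormGroup α β).maximalCompact_le_carrier).comp
      (upqMaximalCompactEquiv (α := α) (β := β)).symm.toMulEquiv.toMonoidHom with hιK
  -- the matrix of `ιK k` is that of `kV k`
  have hιmat : ∀ k : KV α β, (((ιK k : ↥(uFormGroup α β).carrier) : GL (α ⊕ β) ℂ) : Matrix (α ⊕ β) (α ⊕ β) ℂ) =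
      (((UForm.kV α β k : UForm α β) : GL (α ⊕ β) ℂ) : Matrix (α ⊕ β) (α ⊕ β) ℂ) := fun k => rfl
  -- compatibility of the transpose with `K` through `θ = inversion`: `(ιK k)ᵀ = ιK k = (ιK k⁻¹)⁻¹`
  have hσι : ∀ k, σ (ιK k) = (ιK (θ k))⁻¹ := by
    intro k
    rw [hθ k, map_inv, inv_inv]
    apply Subtype.ext
    apply Units.ext
    rw [hσmat, hιmat, coe_kV_transpose_of_subsingleton]
  refine commute_orbitalOp_of_antiHom hσmul θ (measurePreserving_continuousMulEquiv μ θ) hσι ?_ x y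
  intro z
  obtain ⟨u, hu⟩ := hσconj z
  exact ⟨u, hu⟩

/-! ## §3 (LOC) at `U(1,1)`: the Hecke sandwiches of every unitary representation commute -/

/-- **(LOC) AT `U(1,1)`.**  For every unitary strongly continuous representation `σ` of (the carrier of) `U(1,1) = uFormGroup α β` (`|α| = |β| = 1`) on a Hilbert space, `Kfix` the vectors fixed by the
maximal compact `K = U(α) × U(β)` (embedded by `ιK = incl ∘ upqMaximalCompactEquiv⁻¹`) and `P = Kfix.starProjection`: **`∀ x y, Commute (P * σ x * P) (P * σ y * P)`** — §2 and the bridge ★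
`commute_sandwich_of_commute_orbitalOp`; the Haar probability measure of `K` is built here and does not appear in the statement.  This is the per-place letter (LOC) of ★ `K2E1HeckeCommuteGluingU`
at a real place of signature `(1,1)` (the archimedean places of `U(Φ₂)`). [cite: Helgason2000, Ch. IV §3 Thm. 3.1] [cite: Bump1997, Thm. 2.4.2] [cite: DeitmarEchterhoff2014, Lemma 6.1.7] -/
theorem commute_sandwich_uFormGroup_one_one [Unique α] [Unique β] {E : Type*} [NormedAddCommGroup E] [InnerProductSpace ℂ E] [CompleteSpace E]
    (σ : ContRepresentation ℂ ↥(uFormGroup α β).carrier E) (hc : σ.IsStronglyContinuous) (hU : σ.IsUnitary)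
    (Kfix : Submodule ℂ E)
    (hKfix : ∀ v : E, v ∈ Kfix ↔ ∀ k ∈ ((Subgroup.inclusion (uFormGroup α β).maximalCompact_le_carrier).comp
      (upqMaximalCompactEquiv (α := α) (β := β)).symm.toMulEquiv.toMonoidHom).range, σ k v = v)
    [Kfix.HasOrthogonalProjection] (x y : ↥(uFormGroup α β).carrier) :
    Commute (Kfix.starProjection * σ x * Kfix.starProjection) (Kfix.starProjection * σ y * Kfix.starProjection) := by
  classical
  -- the compact abelian group `K₀ = U(α) × U(β)`, its Haar probability measure, and its continuous embedding `ιK`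
  haveI : CompactSpace ↥(Matrix.unitaryGroup α ℂ) := isCompact_iff_compactSpace.mp Matrix.isCompact_unitaryGroup
  haveI : CompactSpace ↥(Matrix.unitaryGroup β ℂ) := isCompact_iff_compactSpace.mp Matrix.isCompact_unitaryGroup
  haveI : SecondCountableTopology (Matrix α α ℂ) := inferInstanceAs (SecondCountableTopology (α → α → ℂ))
  haveI : SecondCountableTopology (Matrix β β ℂ) := inferInstanceAs (SecondCountableTopology (β → β → ℂ))
  haveI : SecondCountableTopology ↥(Matrix.unitaryGroup α ℂ) := TopologicalSpace.Subtype.secondCountableTopology _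
  haveI : SecondCountableTopology ↥(Matrix.unitaryGroup β ℂ) := TopologicalSpace.Subtype.secondCountableTopology _
  haveI : SecondCountableTopology (KV α β) := inferInstance
  letI : MeasurableSpace (KV α β) := borel _
  haveI : BorelSpace (KV α β) := ⟨rfl⟩
  set μ : Measure (KV α β) := haarMeasure ⊤ with hμ
  haveI : IsProbabilityMeasure μ := ⟨by rw [hμ, ← TopologicalSpace.PositiveCompacts.coe_top]; exact haarMeasure_self⟩
  haveI : T2Space (KV α β) := inferInstance
  haveI : IsHaarMeasure μ := by rw [hμ]; infer_instance
  haveI : μ.IsMulRightInvariant := isMulRightInvariant_of_compactSpace μ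
  haveI : μ.IsInvInvariant := isInvInvariant_of_compactSpace μ
  set ιK : KV α β →* ↥(uFormGroup α β).carrier :=
    (Subgroup.inclusion (uFormGroup α β).maximalCompact_le_carrier).comp
      (upqMaximalCompactEquiv (α := α) (β := β)).symm.toMulEquiv.toMonoidHom with hιK
  have hι : Continuous ιK :=
    (Continuous.subtype_mk continuous_subtype_val _).comp (upqMaximalCompactEquiv (α := α) (β := β)).symm.continuous
  exact commute_sandwich_of_commute_orbitalOp μ ιK σ hι hc hU Kfix hKfix (commute_orbitalOp_uFormGroup_one_one μ σ hc hU hι) x y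

end Summit.HodgeConjecture.HodgeConjecture.Cruxes.H413.K2E1HeckeCommuteOfOrbitalU11

end
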